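import Mathlib
import Summits.Ventures.PercRepro2.TypedRowMin

/-!
# (ROW-23*), the mixed (type 2) − (type 3) differences of the typed count (blind cell PercRepro2,
night-3 g19, 2026-08-28; `proofs/NIGHT3-CERT.md` §28.6)

CANDIDATE (ROW-23*), NOT claimed proved: for every set `S` of typed edges and every type map `τ`
with types in `{1, 2}` on the other typed edges, the mixed difference

  `Δ_S N(τ) := Σ_{T ⊆ S} (−1)^{|T|} · N(τ[S ∖ T := 2][T := 3])`

is nonnegative. `|S| = 1` is (ROW-23) (`Row23`); the census (exact, this seat's codes): 0 failures on
6,514 nonzero random cases of orders `1..4` (the rest typed) and on 29,630 random `4 × 4` grids for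
the order-`2` form `Δ_g N(h := 2) ≥ Δ_g N(h := 3)`. READING: the typed counts are the coefficients of
`Gc` in the tensor Bernstein basis `⊗_e {(1 − p)³, p(1 − p)², p²(1 − p), p³}` (`Gc_eq_sum_typedCount`);
with `p³ = p² − p²(1 − p)` the coefficients in `⊗_e {(1 − p)³, p(1 − p)², p²(1 − p), p²}` are exactly
the mixed differences, so (ROW-23*) says that `Gc` lies in the tensor cone of that basis — a cone
strictly inside the Bernstein cone of row 2′TRI.

`Row23Star` is a `def` (Prop); `row23_of_row23Star` is the trivial specialisation to one edge. Own
work; standard axioms.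
-/

namespace Summit.Ventures.PercRepro2

open UnionCluster

namespace CovForm

section Defs

variable {V : Type*} {E : Type*} [Fintype E] [DecidableEq E] {R : Type*} [Field R]
  [LinearOrder R] [IsStrictOrderedRing R]

/-- The type map with the edges of `S ∖ T` set to `2` and those of `T` to `3`. -/
def mixedTypes (τ : E → ℕ) (S T : Finset E) : E → ℕ :=
  fun e => if e ∈ T then 3 else if e ∈ S then 2 else τ e

/-- **The mixed difference** `Δ_S N(τ) = Σ_{T ⊆ S} (−1)^{|T|} N(τ[S ∖ T := 2][T := 3])` of the typed
base of `K₃` over the edge set `S`. -/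
noncomputable def mixedDiff (ends : E → Sym2 V) (o a₁ a₂ a₃ b : V) (F : Finset E) (z : Config E)
    (τ : E → ℕ) (S : Finset E) : R :=
  ∑ T ∈ S.powerset, (-1 : R) ^ T.card *
    typedCount F z (mixedTypes τ S T) (K3 ends o a₁ a₂ a₃ b : Config E → Config E → Config E → R)

/-- **(ROW-23*), a CANDIDATE (not claimed proved)**: every mixed `(2) − (3)` difference of the typed
base over a set `S ⊆ F` of typed edges is nonnegative (types in `{1, 2}` on `F`). -/
def Row23Star (ends : E → Sym2 V) (o a₁ a₂ a₃ b : V) : Prop :=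
  ∀ (F : Finset E) (z : Config E) (τ : E → ℕ) (S : Finset E), S ⊆ F →
    (∀ e ∈ F, τ e = 1 ∨ τ e = 2) →
    0 ≤ mixedDiff (R := R) ends o a₁ a₂ a₃ b F z τ S

end Defs

namespace Row23Red

section Main

variable {V : Type*} {E : Type*} [Fintype E] [DecidableEq E] {R : Type*} [Field R]
  [LinearOrder R] [IsStrictOrderedRing R]
variable (ends : E → Sym2 V) (o a₁ a₂ a₃ b : V)

omit [LinearOrder R] [IsStrictOrderedRing R] in
/-- The mixed difference over a single edge is the ROW-23 gap `N(g := 2) − N(g := 3)`. -/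
lemma mixedDiff_singleton (F : Finset E) (z : Config E) (τ : E → ℕ) (g : E) :
    mixedDiff (R := R) ends o a₁ a₂ a₃ b F z τ {g} =
      typedCount F z (Function.update τ g 2)
          (K3 ends o a₁ a₂ a₃ b : Config E → Config E → Config E → R) -
        typedCount F z (Function.update τ g 3) (K3 ends o a₁ a₂ a₃ b) := by
  unfold mixedDiff
  have hp : ({g} : Finset E).powerset = {∅, {g}} := by
    rw [← Finset.insert_empty, Finset.powerset_insert, Finset.powerset_empty]
    simp
  rw [hp, Finset.sum_pair (Finset.empty_ne_singleton g)]
  have h2 : mixedTypes τ {g} ∅ = Function.update τ g 2 := by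
    funext e
    unfold mixedTypes
    by_cases he : e = g
    · subst he; simp
    · simp [he]
  have h3 : mixedTypes τ {g} {g} = Function.update τ g 3 := by
    funext e
    unfold mixedTypes
    by_cases he : e = g
    · subst he; simp
    · simp [he]
  rw [h2, h3]
  simp only [Finset.card_empty, pow_zero, one_mul, Finset.card_singleton, pow_one, neg_one_mul]
  ring

/-- **(ROW-23*) contains (ROW-23)**: the one-edge mixed differences. -/
theorem row23_of_row23Star (h : Row23Star (R := R) ends o a₁ a₂ a₃ b) :
    Row23 (R := R) ends o a₁ a₂ a₃ b := by
  intro F z τ g hg hg2 hτ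
  have hτ' : ∀ e ∈ F, Function.update τ g 2 e = 1 ∨ Function.update τ g 2 e = 2 := by
    intro e he
    by_cases heg : e = g
    · subst heg; right; exact Function.update_self _ _ _
    · rw [Function.update_of_ne heg]; exact hτ e he
  have h1 := h F z (Function.update τ g 2) {g} (Finset.singleton_subset_iff.2 hg) hτ'
  rw [mixedDiff_singleton] at h1
  have e2 : Function.update (Function.update τ g 2) g 2 = τ := by
    rw [Function.update_idem]
    rw [← hg2]; exact Function.update_eq_self g τ
  have e3 : Function.update (Function.update τ g 2) g 3 = Function.update τ g 3 :=
    Function.update_idem _ _ _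
  rw [e2, e3] at h1
  linarith

/-- **Row 2′TRI from (ROW-23*) and (ROW-MIN).** -/
theorem typedBases_of_row23Star_rowMin (h : Row23Star (R := R) ends o a₁ a₂ a₃ b)
    (hmin : RowMin (R := R) ends o a₁ a₂ a₃ b) : TypedBases (R := R) ends o a₁ a₂ a₃ b :=
  typedBases_of_row23_rowMin ends o a₁ a₂ a₃ b (row23_of_row23Star ends o a₁ a₂ a₃ b h) hmin

end Main

end Row23Red

end CovForm

end Summit.Ventures.PercRepro2
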